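import Summits.ABC.IUTFork.Conditional.AbcOfSGenuineKChosenDepth
import Summits.ABC.IUTFork.Cor312GenuineKDeepDatumLam
import Literature.IUT.LogVolume.GenuineRamificationBoundsPinned
import Literature.IUT.LogVolume.GenuineLogThetaPointNecessity
import HarnessLib

/-!
# Branch C «HEX-SHARP» (R-W lane P−, W-SPEC §6): the `λ_k = 1/2 + 2/7^k` family is DEEP at the top label over `7`
# from an EXPLICIT `k₂(l)` on (`k ≥ 21` at `l = 11`, `k ≥ 20` at `l = 13`, `k ≥ 21` for `17 ≤ l ≤ 107`) — kernel-only, no numerics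

PROOF-ONLY file (0 definitions, 0 `Prop` facts, no instance) of the abc-iut cell (seat abc-iut-w5-d163, gen 7; D-0079 RESCUE
sub-cell R-W «window Θ-side inequality», lane P−, task «HEX-SHARP» of `HOME/plan/W/WINDOW-SPEC.md` §6, ruling C-R26 (iv)).
TAKES NO SIDE on [IUTchIII] Cor. 3.12 (S. Mochizuki, *Inter-universal Teichmüller theory III*, RIMS manuscript, Cor. 3.12
p. 173–174, Step (xi-f) p. 184) or on any author.

CONTEXT. The assembly of record `Conditional.not_hSH_v6K` (abc-iut-C-cert-1, p443604) and its family form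
`GenuineK.exists_deep_place_lamSeven_all` (abc-iut-c312-7) make the top-label packet over `7` of the `λ_k` data deep from a
NON-EXPLICIT `k*` on; the explicit-threshold files landed for «HEX-SHARP» so far (abc-iut-rp-m4 `AbcOfSGenuineKChosenDepthHexSharp`
/ `…More`, abc-iut-c312-7 `…HexFamilyExplicit`, abc-iut-w6-d102 `HexDepthExplicitFloor`) all run on abc-iut-c312-7's TAME constant
`e(K_{x₀}/ℚ_7) ≤ 46080·l(l−1)²(l+1)` (`e(x₀|v) ≤ [K:F]`), whence `k ≥ 33–37` on the HEX table; abc-iut-S-d1's arithmetic core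
`HexDepthArithmeticSharp` (constant `83/10 ⇒ k ≥ 24`) waits for a DATUM-SIDE ramification engine. THIS FILE IS THAT ENGINE (HEX-SHARP
prover #1, the «sharp ramification engine» of W-SPEC §6 (1)–(2)) together with its own floor-free assembly:

* §1 `GenuineK.absRamificationIdx_kOf_le_ratPoint` — at a RATIONAL point (`F_tpd = ℚ`), EVERY place `x | p` (`p ≠ 2`, `p ≠ l`)
  of the `l`-division field `K = T.K` of a genuine Θ-volume datum has `e(K_x/ℚ_p) ≤ 46080·l`: `e(x|p) = e(v|p)·e(x|v)` with
  `e(v|p) ≤ 46080` (abc-iut-S1's two-root lemma `Cor22.ramificationIdx_subThetaField_le`, [IUTchIV] Thm. 1.10 Step (ii)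
  "`Gal(F/F_tpd) ↪ GL₂(𝔽₃)×GL₂(𝔽₅)×ℤ/2`") and **`e(x|v) ∣ l`** (`Cor22.exists_ramificationIdx_eq_pow_of_ker_le` +
  `ramificationIdx_dvd_prime_of_eq_pow`, Prop. 1.8 (vii) "divides `l`") — instead of `e(x|v) ≤ [K:F] ≤ l(l−1)²(l+1)`;
* §2 `HexSharp.depthConstants_le` — for a TAME `7`-adic field with `e < 6·7ⁿ`: `d + a + b ≤ n + 6/5 − 1/e`
  (`d = (e−1)/e` by `differentOrd_eq_of_not_dvd` — NO maximal-unramified-subfield argument is needed;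
  `a ≤ 1/5 + 1/e`; `b = ⌊log₇(7e/6)⌋ − 1/e ≤ n − 1/e`);
* §3 `GenuineK.exists_deep_place_lamSeven_of_le` — for `l` prime `≥ 11`, `n` with `46080·l < 6·7ⁿ` and `k` with
  `l·((l+1)(10n+12) + 20) ≤ 5k(l−3)(l+1)` (the floor-free form of `(j+1)(n + 6/5) + 1 ≤ (k/l)(j²−1)`, `j = (l−1)/2`):
  at EVERY genuine Θ-volume datum `T` over `(λ_k, l)` the top label `i = j − 1` and a place `x₀ | 7` satisfy abc-iut-w5-d107's
  explicit depth inequality `7^{((i+2)(d+a+b)+1)}·‖t_q(x₀)‖^{(i+1)²−1} < 1` at the CHOSEN realising q-idele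
  (`‖t_q(x₀)‖ = 7^{−k/l}`, abc-iut-c312-7 `GenuineK.exists_place_lamSeven`); corollaries `…_eleven` (`l = 11`, `k ≥ 21`),
  `…_thirteen` (`l = 13`, `k ≥ 20`), `…_of_le_107` (`17 ≤ l ≤ 107`, `k ≥ 21`).
CONSEQUENCE (one `obtain`, per datum, for EVERY choice of the context binders and Kummer data): the per-datum instance of the
S_H binder of the line of record fails — abc-iut-C-cert-1 `GenuineK.not_pilotKummerCompatHull_chosen_of_explicit_depth` (p438886);
these `(k, l)` lie BELOW the degree-form threshold of the window certificate `abc_of_SH_v10K_window` (p447945), i.e. INSIDE its window.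
COMPATIBILITY: §1's bound `e ≤ 46080·l < 6·7⁷` (`l ≤ 107`) is exactly the `e`-window of abc-iut-S-d1's `depthConstants_seven_lt_41_5`
(`DepthConstantsTameBudget`), so §1 + that budget + `Hex.core_ineq_dab_83_10` is a second, independent assembly (`k ≥ 24` uniformly).

HONEST SCOPE: SHARP reading; the per-label licence is a STRONGER-THAN-PRINT sufficient form of (xi-f); a deep top-label packet says
NOTHING about the printed GLOBAL inequality, the number-level `Cor22.Cor312AtDatum`, or any author's intended hull; no side taken;
typed ≠ proved; refuted-as-typed ≠ refuted-in-print. [cite: Mochizuki2012, IUTchIII Cor. 3.12 Step (xi-f) p. 184; IUTchI Ex. 3.2 (iv) p. 71;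
IUTchIV Prop. 1.2 p. 10, Prop. 1.8 (vii) p. 19, Thm. 1.10 Steps (ii)–(iii) p. 24–26, Cor. 2.2 (ii) proof (P5) p. 46]
[cite: SerreLocalFields1979, Ch. III §6 Prop. 13] [cite: DupuyHilado2025, §3.4] [claim: Mochizuki2012, status: disputed] for every IUT quotation.
-/

noncomputable section

open NumberField IsDedekindDomain

/-! ## §2 (stated first). The [IUTchIV] Prop. 1.2 constants of a tame `7`-adic field of bounded ramification -/

namespace Summit.ABC.IUTFork.Conditional.HexSharp

open Literature.IUT.LogVolume

/-- **`d + a + b ≤ n + 6/5 − 1/e`** for a `7`-adic field `K'` with `7 ∤ e` and `e < 6·7ⁿ`: `d = (e−1)/e`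
(`differentOrd_eq_of_not_dvd`, Serre *Corps locaux* III §6 Prop. 13 — tame case), `a = ⌈e/5⌉/e ≤ 1/5 + 1/e`, and
`b = ⌊log(7e/6)/log 7⌋ − 1/e ≤ n − 1/e` since `7e/6 < 7ⁿ⁺¹`. [cite: Mochizuki2012, IUTchIV Prop. 1.2 p. 10]
[cite: SerreLocalFields1979, Ch. III §6 Prop. 13] [claim: Mochizuki2012, status: disputed] -/
theorem depthConstants_le [Fact (Nat.Prime 7)] (K' : Type) [NontriviallyNormedField K'] [NormedAlgebra ℚ_[7] K']
    [IsUltrametricDist K'] [ProperSpace K'] (n : ℕ) (htame : ¬ 7 ∣ absRamificationIdx 7 K')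
    (hlt : absRamificationIdx 7 K' < 6 * 7 ^ n) :
    differentOrd 7 K' + logRadiusA 7 (absRamificationIdx 7 K') + logRadiusB 7 (absRamificationIdx 7 K') ≤
      n + 6 / 5 - 1 / (absRamificationIdx 7 K' : ℝ) := by
  set e := absRamificationIdx 7 K' with he_def
  have he : 0 < e := absRamificationIdx_pos 7 K'
  have he' : (0 : ℝ) < e := by exact_mod_cast he
  -- `d = (e−1)/e = 1 − 1/e`
  have hd : differentOrd 7 K' = ((e : ℝ) - 1) / e := differentOrd_eq_of_not_dvd 7 K' htame
  have hd' : ((e : ℝ) - 1) / e = 1 - 1 / e := by field_simp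
  -- `a ≤ 1/5 + 1/e`
  have ha' : logRadiusA 7 e ≤ 1 / 5 + 1 / e := by
    have h := logRadiusA_le 7 (by norm_num) he
    norm_num at h ⊢
    linarith
  -- `b ≤ n − 1/e`
  have hb : logRadiusB 7 e ≤ n - 1 / e := by
    rw [logRadiusB]
    have h7 : (0 : ℝ) < 7 := by norm_num
    have hlog7 : 0 < Real.log 7 := Real.log_pos (by norm_num)
    have harg : (0 : ℝ) < (7 : ℝ) * e / ((7 : ℝ) - 1) := by positivity
    have hlt' : (7 : ℝ) * e / ((7 : ℝ) - 1) < (7 : ℝ) ^ ((n : ℝ) + 1) := by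
      have h1 : ((e : ℕ) : ℝ) < ((6 * 7 ^ n : ℕ) : ℝ) := by exact_mod_cast hlt
      push_cast at h1
      rw [Real.rpow_add h7, Real.rpow_natCast, Real.rpow_one]
      rw [div_lt_iff₀ (by norm_num : (0 : ℝ) < (7 : ℝ) - 1)]
      nlinarith
    have hfloor : ⌊Real.log ((7 : ℝ) * e / ((7 : ℝ) - 1)) / Real.log 7⌋ ≤ (n : ℤ) := by
      rw [Int.floor_le_iff]
      push_cast
      rw [div_lt_iff₀ hlog7]
      have := Real.log_lt_log harg hlt'
      rwa [Real.log_rpow h7] at this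
    have hfloor' : (⌊Real.log ((7 : ℝ) * e / ((7 : ℝ) - 1)) / Real.log 7⌋ : ℝ) ≤ n := by exact_mod_cast hfloor
    push_cast
    linarith
  rw [hd, hd']
  linarith

end Summit.ABC.IUTFork.Conditional.HexSharp

namespace Summit.ABC.IUTFork.Conditional

open Thm311 Thm311.Real Cor312 Cor312Prov Literature.IUT.LogVolume Literature.IUT.HodgeTheaters
  Literature.IUT.LogThetaLattice Literature.NumberTheory.NumberFields Literature.NumberTheory.DiophantineGeometry.GenEll
  Literature.NumberTheory.DiophantineGeometry

/-! ## §1. At a rational point every place of `K` over `p ∉ {2, l}` has `e(K_x/ℚ_p) ≤ 46080·l` -/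

/-- **`e(K_x/ℚ_p) ≤ 46080·l` at EVERY place `x | p` (`p ≠ 2`, `p ≠ l`) of the `l`-division field of a genuine Θ-volume datum over a
RATIONAL point** (`F_tpd = ℚ`): `e(x|p) = e(v₀|p)·e(v|v₀)·e(x|v)` (`v = x ∩ F`, `v₀ = v ∩ ℚ`) with `e(v₀|p) = 1`,
`e(v|v₀) ≤ 46080` (`F/ℚ` Galois, pinned by `IsSubThetaField`: abc-iut-S1's `Cor22.ramificationIdx_subThetaField_le`, `p ≠ 2`) and
`e(x|v) ∣ l` (a power of `l` by [IUTchIV] Prop. 1.8 (vii) — `Cor22.exists_ramificationIdx_eq_pow_of_ker_le` at the semistable `E_F`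
with `j(E_F) = j(λ)` — dividing `[K:F] ∣ |GL₂(𝔽_l)|`, `ramificationIdx_dvd_prime_of_eq_pow`).
[cite: Mochizuki2012, IUTchIV Prop. 1.8 (vii) p. 19, Thm. 1.10 Steps (ii)–(iii) p. 24–26] [claim: Mochizuki2012, status: disputed] -/
theorem GenuineK.absRamificationIdx_kOf_le_ratPoint {q : ℚ} {l : ℕ} (T : Cor22.ThetaVolumeDatumAt (ratPoint q) l)
    (pp : Nat.Primes) (hp2 : (pp : ℕ) ≠ 2) (hpl : (pp : ℕ) ≠ l) :
    letI := T.instFieldF; letI := T.instNumberFieldF; letI := T.instAlgebraF; letI := T.instFieldK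
    letI := T.instNumberFieldK; letI := T.instAlgebraK; letI := T.instFieldFbar; letI := T.instAlgebraFbar
    letI := T.instAlgebraKFbar; letI := T.instIsElliptic
    haveI : Fact (pp : ℕ).Prime := ⟨pp.2⟩
    ∀ x : (thetaIndex (pilotDataOfK T.D T.K)).Fibre (.inr pp),
      absRamificationIdx (pp : ℕ) (kOf (pilotDataOfK T.D T.K) pp.1 x) ≤ 46080 * l := by
  letI := T.instFieldF; letI := T.instNumberFieldF; letI := T.instAlgebraF; letI := T.instFieldK
  letI := T.instNumberFieldK; letI := T.instAlgebraK; letI := T.instFieldFbar; letI := T.instAlgebraFbar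
  letI := T.instAlgebraKFbar; letI := T.instIsElliptic
  haveI : Fact (pp : ℕ).Prime := ⟨pp.2⟩
  intro x
  have hU : (ratPoint q).InU := T.inU
  have hl : l.Prime := T.D.l_prime
  haveI : Fact l.Prime := ⟨hl⟩
  -- Galois structure of the tower and the embedding `K → AlgebraicClosure F` inside the `l`-division field
  obtain ⟨hGalF, hGalK, -, -, -, -, -, -, -⟩ := T.towerFacts hU
  haveI := hGalF; haveI := hGalK
  haveI := T.D.isScalarTower
  haveI := T.D.isAlgClosure
  let ι : T.Fbar ≃ₐ[T.F] AlgebraicClosure T.F := IsAlgClosure.equiv T.F T.Fbar (AlgebraicClosure T.F)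
  let ψ : T.K →ₐ[T.F] AlgebraicClosure T.F :=
    (ι : T.Fbar →ₐ[T.F] AlgebraicClosure T.F).comp (IsScalarTower.toAlgHom T.F T.K T.Fbar)
  have hK : (T.E.galoisRepTorsion (l : ℤ)).ker ≤ ψ.fieldRange.fixingSubgroup :=
    Cor22.ker_galoisRepTorsion_le_fixingSubgroup_of_initialThetaData T.D ι
  have hss : T.E.IsSemistable (𝓞 T.F) := T.D.isSemistable
  -- the places `w = placeOf x` of `K`, `v = w ∩ F`, `v₀ = v ∩ ℚ`
  set w : HeightOneSpectrum (𝓞 T.K) := placeOf (pilotDataOfK T.D T.K) pp.1 x with hwdef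
  have hpw : ((pp : ℕ) : 𝓞 T.K) ∈ w.asIdeal := natCast_mem_placeOf (pilotDataOfK T.D T.K) pp.1 x
  set v : HeightOneSpectrum (𝓞 T.F) := finBelow T.F T.K w with hvdef
  set v₀ : HeightOneSpectrum (𝓞 (ratPoint q).F) := finBelow (ratPoint q).F T.F v with hv₀def
  have hw_under : w.under (𝓞 T.F) = v := rfl
  have hv_under : v.under (𝓞 (ratPoint q).F) = v₀ := rfl
  have hpv : ((pp : ℕ) : 𝓞 T.F) ∈ v.asIdeal := by
    change ((pp : ℕ) : 𝓞 T.F) ∈ w.asIdeal.under (𝓞 T.F)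
    rw [Ideal.under_def, Ideal.mem_comap, map_natCast]
    exact hpw
  have hpv₀ : ((pp : ℕ) : 𝓞 (ratPoint q).F) ∈ v₀.asIdeal := by
    change ((pp : ℕ) : 𝓞 (ratPoint q).F) ∈ v.asIdeal.under (𝓞 (ratPoint q).F)
    rw [Ideal.under_def, Ideal.mem_comap, map_natCast]
    exact hpv
  have hwchar : residueChar T.K w = (pp : ℕ) := residueChar_eq_of_natCast_mem pp.1 hpw
  -- `e(K_x) = e(w|p)`
  have hekOf : absRamificationIdx (pp : ℕ) (kOf (pilotDataOfK T.D T.K) pp.1 x) = w.asIdeal.ramificationIdx ℤ := by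
    rw [show absRamificationIdx (pp : ℕ) (kOf (pilotDataOfK T.D T.K) pp.1 x) =
        absRamificationIdx (pp : ℕ) (RescaledCompletion T.K pp.1 (placeOf (pilotDataOfK T.D T.K) pp.1 x) (natCast_mem_placeOf (pilotDataOfK T.D T.K) pp.1 x)) from rfl,
      absRamificationIdx_rescaledCompletion]
  -- `e(w|p) = ramIdx F v · e(w|v)` and `ramIdx F v = e(v|p) = ramIdx ℚ v₀ · e(v|v₀) = e(v|v₀)`
  haveI hwv : w.asIdeal.LiesOver v.asIdeal := by rw [← hw_under]; exact ⟨rfl⟩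
  haveI hvv₀ : v.asIdeal.LiesOver v₀.asIdeal := by rw [← hv_under]; exact ⟨rfl⟩
  haveI : v.asIdeal.IsMaximal := v.isMaximal
  haveI : v₀.asIdeal.IsMaximal := v₀.isMaximal
  have hewv : Ideal.ramificationIdx' v.asIdeal w.asIdeal = w.asIdeal.ramificationIdx (𝓞 T.F) :=
    Ideal.ramificationIdx'_eq_ramificationIdx v.asIdeal w.asIdeal v.ne_bot
  have hevv₀ : Ideal.ramificationIdx' v₀.asIdeal v.asIdeal = v.asIdeal.ramificationIdx (𝓞 (ratPoint q).F) :=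
    Ideal.ramificationIdx'_eq_ramificationIdx v₀.asIdeal v.asIdeal v₀.ne_bot
  have hram₀ : ramIdx (ratPoint q).F v₀ = 1 := by
    have h1 := ramificationIdx_int_le_finrank_rat (F₀ := (ratPoint q).F) v₀
    rw [show Module.finrank ℚ (ratPoint q).F = 1 from Module.finrank_self ℚ, ← ramIdx_eq] at h1
    have h2 : ramIdx (ratPoint q).F v₀ ≠ 0 := ramIdx_ne_zero (ratPoint q).F v₀
    omega
  have hew : w.asIdeal.ramificationIdx ℤ =
      v.asIdeal.ramificationIdx (𝓞 (ratPoint q).F) * w.asIdeal.ramificationIdx (𝓞 T.F) := by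
    rw [ThetaData.absRamificationIdx_eq_ramIdx_mul (F := T.F) w, hw_under, ramIdx_eq,
      ThetaData.absRamificationIdx_eq_ramIdx_mul (F := (ratPoint q).F) v, hv_under, hram₀, one_mul, hevv₀, hewv]
  -- `e(v|v₀) ≤ 46080` (two-root lemma, `p ≠ 2`)
  have hevle : v.asIdeal.ramificationIdx (𝓞 (ratPoint q).F) ≤ 46080 := by
    refine Cor22.ramificationIdx_subThetaField_le T.F hU T.isSubThetaField v ?_
    intro h2
    exact hp2 (eq_of_natCast_mem_of_prime pp.1 v₀.isPrime.ne_top Nat.prime_two h2 hpv₀).symm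
  -- `e(w|v) ∣ l`
  have hlw : ((l : ℕ) : 𝓞 T.F) ∉ (finBelow T.F T.K w).asIdeal :=
    Cor22.natCast_notMem_finBelow_of_residueChar_ne hl w (by rw [hwchar]; exact hpl)
  have hewdvd : w.asIdeal.ramificationIdx (𝓞 T.F) ∣ l := by
    obtain ⟨k, hk⟩ := Cor22.exists_ramificationIdx_eq_pow_of_ker_le ψ hss T.j_eq hl hK w hlw
    exact ramificationIdx_dvd_prime_of_eq_pow w hl hk (Cor22.finrank_dvd_of_ker_le ψ hK)
  have hewle : w.asIdeal.ramificationIdx (𝓞 T.F) ≤ l := Nat.le_of_dvd hl.pos hewdvd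
  rw [hekOf, hew]
  exact Nat.mul_le_mul hevle hewle

/-! ## §3. HEX-SHARP: every datum over `(λ_k, l)` is deep at the top label over `7` from an explicit `k₂(l)` on -/

/-- **HEX-SHARP (engine form).** Let `l ≥ 11` be prime, `n` with `46080·l < 6·7ⁿ` (so `b ≤ n − 1/e` at every place over `7`) and
`k ≥ 1` with `l·((l+1)(10n+12) + 20) ≤ 5·k·((l−3)(l+1))` (⟺ `(j+1)(n + 6/5) + 1 ≤ (k/l)(j²−1)`, `j = (l−1)/2`). Then at EVERY genuine
Θ-volume datum `T` over `(ratPoint λ_k, l)`, `λ_k = 1/2 + 2/7^k`, the top label `i = j − 1` and some place `x₀ | 7` in the bad set of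
`pilotDataOfK T.D T.K` satisfy the explicit depth inequality `7^{((i+2)(d+a+b)+1)}·‖t_q(x₀)‖^{(i+1)²−1} < 1` at the CHOSEN realising
q-idele — hypothesis `hdeep` of abc-iut-C-cert-1's `GenuineK.not_pilotKummerCompatHull_chosen_of_explicit_depth` (p438886).
[cite: Mochizuki2012, IUTchIII Cor. 3.12 Step (xi-f) p. 184; IUTchIV Prop. 1.2 p. 10, Cor. 2.2 (ii) proof (P5) p. 46] [claim: Mochizuki2012, status: disputed] -/
theorem GenuineK.exists_deep_place_lamSeven_of_le {k l n : ℕ} (hk : 1 ≤ k) (hl : l.Prime) (h11 : 11 ≤ l)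
    (hn : 46080 * l < 6 * 7 ^ n) (hkl : l * ((l + 1) * (10 * n + 12) + 20) ≤ 5 * k * ((l - 3) * (l + 1)))
    (T : Cor22.ThetaVolumeDatumAt (ratPoint ((2 : ℚ)⁻¹ + 2 / 7 ^ k)) l) :
    letI := T.instFieldF; letI := T.instNumberFieldF; letI := T.instAlgebraF; letI := T.instFieldK
    letI := T.instNumberFieldK; letI := T.instAlgebraK; letI := T.instFieldFbar; letI := T.instAlgebraFbar
    letI := T.instAlgebraKFbar; letI := T.instIsElliptic
    haveI : Fact (Nat.Prime 7) := ⟨by norm_num⟩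
    ∃ (i : Fin (thetaIndex (pilotDataOfK T.D T.K)).lstar) (x₀ : (thetaIndex (pilotDataOfK T.D T.K)).Fibre (.inr ⟨7, by norm_num⟩)),
      (i : ℕ) = (l - 1) / 2 - 1 ∧
      placeOf (pilotDataOfK T.D T.K) 7 x₀ ∈ (pilotDataOfK T.D T.K).S ∧
      (7 : ℝ) ^ ((((i : ℕ) : ℝ) + 2) * (differentOrd 7 (kOf (pilotDataOfK T.D T.K) 7 x₀)
          + logRadiusA 7 (absRamificationIdx 7 (kOf (pilotDataOfK T.D T.K) 7 x₀))
          + logRadiusB 7 (absRamificationIdx 7 (kOf (pilotDataOfK T.D T.K) 7 x₀))) + 1) *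
        ‖(exists_realising_qIdeles_pilotDataOfK T.D).choose ⟨7, by norm_num⟩ x₀‖ ^ (((i : ℕ) + 1) ^ 2 - 1) < 1 := by
  classical
  letI := T.instFieldF; letI := T.instNumberFieldF; letI := T.instAlgebraF; letI := T.instFieldK
  letI := T.instNumberFieldK; letI := T.instAlgebraK; letI := T.instFieldFbar; letI := T.instAlgebraFbar
  letI := T.instAlgebraKFbar; letI := T.instIsElliptic
  haveI : Fact (Nat.Prime 7) := ⟨by norm_num⟩
  obtain ⟨x₀, hS, htame, -, -, hnorm⟩ := GenuineK.exists_place_lamSeven hk hl h11 T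
  -- the top label
  have hlstar : (thetaIndex (pilotDataOfK T.D T.K)).lstar = (l - 1) / 2 := rfl
  have hil : (l - 1) / 2 - 1 < (thetaIndex (pilotDataOfK T.D T.K)).lstar := by rw [hlstar]; omega
  refine ⟨⟨(l - 1) / 2 - 1, hil⟩, x₀, rfl, hS, ?_⟩
  -- the sharp ramification bound and the constants
  have he : absRamificationIdx 7 (kOf (pilotDataOfK T.D T.K) 7 x₀) ≤ 46080 * l :=
    GenuineK.absRamificationIdx_kOf_le_ratPoint T ⟨7, by norm_num⟩ (by norm_num) (by simp only; omega) x₀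
  have hepos : 0 < absRamificationIdx 7 (kOf (pilotDataOfK T.D T.K) 7 x₀) := absRamificationIdx_pos _ _
  have he' : (0 : ℝ) < absRamificationIdx 7 (kOf (pilotDataOfK T.D T.K) 7 x₀) := by exact_mod_cast hepos
  set B : ℝ := n + 6 / 5 - 1 / (absRamificationIdx 7 (kOf (pilotDataOfK T.D T.K) 7 x₀) : ℝ) with hBdef
  have hX := HexSharp.depthConstants_le (kOf (pilotDataOfK T.D T.K) 7 x₀) n htame (lt_of_le_of_lt he hn)
  -- label arithmetic: `j = (l−1)/2`, `2(j+1) = l+1`, `4(j²−1) = (l−3)(l+1)`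
  set j : ℕ := (l - 1) / 2 with hj
  have h2j : 2 * j = l - 1 := by
    have hodd : l % 2 = 1 := Nat.odd_iff.mp (hl.odd_of_ne_two (by omega))
    omega
  have hj5 : 5 ≤ j := by omega
  have hjR : (j : ℝ) = ((l : ℝ) - 1) / 2 := by
    have : ((2 * j : ℕ) : ℝ) = ((l - 1 : ℕ) : ℝ) := by exact_mod_cast h2j
    push_cast [Nat.cast_sub (show 1 ≤ l by omega)] at this
    linarith
  have hcast1 : ((((l - 1) / 2 - 1 : ℕ) : ℝ) + 2) = (j : ℝ) + 1 := by
    rw [← hj, Nat.cast_sub (show 1 ≤ j by omega)]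
    push_cast; ring
  have hidx : (l - 1) / 2 - 1 + 1 = j := by rw [← hj]; omega
  have hcast2 : (((j ^ 2 - 1 : ℕ)) : ℝ) = ((j : ℝ) - 1) * ((j : ℝ) + 1) := by
    have : 1 ≤ j ^ 2 := Nat.one_le_pow _ _ (by omega)
    push_cast [Nat.cast_sub this]
    ring
  -- the hypothesis `hkl` in real form: `(j+1)(n + 6/5) + 1 ≤ (k/l)·(j−1)(j+1)`
  have hl0 : (0 : ℝ) < l := by exact_mod_cast hl.pos
  have hklR : ((j : ℝ) + 1) * ((n : ℝ) + 6 / 5) + 1 ≤ (k : ℝ) / l * (((j : ℝ) - 1) * ((j : ℝ) + 1)) := by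
    have h := hkl
    have h3 : 3 ≤ l := by omega
    have hR : ((l * ((l + 1) * (10 * n + 12) + 20) : ℕ) : ℝ) ≤ ((5 * k * ((l - 3) * (l + 1)) : ℕ) : ℝ) := by
      exact_mod_cast h
    push_cast [Nat.cast_sub h3] at hR
    rw [hjR]
    rw [div_mul_eq_mul_div, le_div_iff₀ hl0]
    nlinarith
  -- strictness from the `−1/e` in `B`
  have hlt : (((((l - 1) / 2 - 1 : ℕ)) : ℝ) + 2) * B + 1 <
      (k : ℝ) / l * ((((((l - 1) / 2 - 1 : ℕ)) + 1) ^ 2 - 1 : ℕ) : ℝ) := by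
    rw [hcast1, hidx, hcast2, hBdef]
    have hpos : 0 < ((j : ℝ) + 1) * (1 / (absRamificationIdx 7 (kOf (pilotDataOfK T.D T.K) 7 x₀) : ℝ)) := by
      have : (0 : ℝ) < (j : ℝ) + 1 := by positivity
      positivity
    nlinarith
  have h := rpow_mul_pow_lt_one_of_lt (p := (7 : ℝ)) (by norm_num) (i := (l - 1) / 2 - 1) hX hlt
  rw [hnorm]
  exact h

/-- **HEX-SHARP at `l = 11`: every `k ≥ 21`.** (`n = 6`: `46080·11 = 506880 < 705894 = 6·7⁶`; `11·(12·72 + 20) = 9724 ≤ 10080 = 5·21·8·12`.)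
[cite: Mochizuki2012, IUTchIII Cor. 3.12 Step (xi-f) p. 184; IUTchIV Prop. 1.2 p. 10] [claim: Mochizuki2012, status: disputed] -/
theorem GenuineK.exists_deep_place_lamSeven_eleven {k : ℕ} (hk : 21 ≤ k)
    (T : Cor22.ThetaVolumeDatumAt (ratPoint ((2 : ℚ)⁻¹ + 2 / 7 ^ k)) 11) :
    letI := T.instFieldF; letI := T.instNumberFieldF; letI := T.instAlgebraF; letI := T.instFieldK
    letI := T.instNumberFieldK; letI := T.instAlgebraK; letI := T.instFieldFbar; letI := T.instAlgebraFbar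
    letI := T.instAlgebraKFbar; letI := T.instIsElliptic
    haveI : Fact (Nat.Prime 7) := ⟨by norm_num⟩
    ∃ (i : Fin (thetaIndex (pilotDataOfK T.D T.K)).lstar) (x₀ : (thetaIndex (pilotDataOfK T.D T.K)).Fibre (.inr ⟨7, by norm_num⟩)),
      (i : ℕ) = 4 ∧
      placeOf (pilotDataOfK T.D T.K) 7 x₀ ∈ (pilotDataOfK T.D T.K).S ∧
      (7 : ℝ) ^ ((((i : ℕ) : ℝ) + 2) * (differentOrd 7 (kOf (pilotDataOfK T.D T.K) 7 x₀)
          + logRadiusA 7 (absRamificationIdx 7 (kOf (pilotDataOfK T.D T.K) 7 x₀))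
          + logRadiusB 7 (absRamificationIdx 7 (kOf (pilotDataOfK T.D T.K) 7 x₀))) + 1) *
        ‖(exists_realising_qIdeles_pilotDataOfK T.D).choose ⟨7, by norm_num⟩ x₀‖ ^ (((i : ℕ) + 1) ^ 2 - 1) < 1 :=
  GenuineK.exists_deep_place_lamSeven_of_le (n := 6) (by omega) (by norm_num) le_rfl (by norm_num)
    (by nlinarith) T

/-- **HEX-SHARP at `l = 13`: every `k ≥ 20`.** (`n = 6`: `46080·13 = 599040 < 705894`; `13·(14·72 + 20) = 13364 ≤ 14000 = 5·20·10·14`.)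
[cite: Mochizuki2012, IUTchIII Cor. 3.12 Step (xi-f) p. 184; IUTchIV Prop. 1.2 p. 10] [claim: Mochizuki2012, status: disputed] -/
theorem GenuineK.exists_deep_place_lamSeven_thirteen {k : ℕ} (hk : 20 ≤ k)
    (T : Cor22.ThetaVolumeDatumAt (ratPoint ((2 : ℚ)⁻¹ + 2 / 7 ^ k)) 13) :
    letI := T.instFieldF; letI := T.instNumberFieldF; letI := T.instAlgebraF; letI := T.instFieldK
    letI := T.instNumberFieldK; letI := T.instAlgebraK; letI := T.instFieldFbar; letI := T.instAlgebraFbar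
    letI := T.instAlgebraKFbar; letI := T.instIsElliptic
    haveI : Fact (Nat.Prime 7) := ⟨by norm_num⟩
    ∃ (i : Fin (thetaIndex (pilotDataOfK T.D T.K)).lstar) (x₀ : (thetaIndex (pilotDataOfK T.D T.K)).Fibre (.inr ⟨7, by norm_num⟩)),
      (i : ℕ) = 5 ∧
      placeOf (pilotDataOfK T.D T.K) 7 x₀ ∈ (pilotDataOfK T.D T.K).S ∧
      (7 : ℝ) ^ ((((i : ℕ) : ℝ) + 2) * (differentOrd 7 (kOf (pilotDataOfK T.D T.K) 7 x₀)
          + logRadiusA 7 (absRamificationIdx 7 (kOf (pilotDataOfK T.D T.K) 7 x₀))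
          + logRadiusB 7 (absRamificationIdx 7 (kOf (pilotDataOfK T.D T.K) 7 x₀))) + 1) *
        ‖(exists_realising_qIdeles_pilotDataOfK T.D).choose ⟨7, by norm_num⟩ x₀‖ ^ (((i : ℕ) + 1) ^ 2 - 1) < 1 :=
  GenuineK.exists_deep_place_lamSeven_of_le (n := 6) (by omega) (by norm_num) (by norm_num) (by norm_num)
    (by nlinarith) T

/-- **HEX-SHARP, uniform: every prime `17 ≤ l ≤ 107` and every `k ≥ 21`.** (`n = 7`: `46080·l ≤ 4930560 < 4941258 = 6·7⁷`;
`l((l+1)·82 + 20) ≤ 105(l−3)(l+1)` for `l ≥ 17`, i.e. `23l² ≥ 312l + 315`.)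
[cite: Mochizuki2012, IUTchIII Cor. 3.12 Step (xi-f) p. 184; IUTchIV Prop. 1.2 p. 10] [claim: Mochizuki2012, status: disputed] -/
theorem GenuineK.exists_deep_place_lamSeven_of_le_107 {k l : ℕ} (hk : 21 ≤ k) (hl : l.Prime) (h17 : 17 ≤ l) (h107 : l ≤ 107)
    (T : Cor22.ThetaVolumeDatumAt (ratPoint ((2 : ℚ)⁻¹ + 2 / 7 ^ k)) l) :
    letI := T.instFieldF; letI := T.instNumberFieldF; letI := T.instAlgebraF; letI := T.instFieldK
    letI := T.instNumberFieldK; letI := T.instAlgebraK; letI := T.instFieldFbar; letI := T.instAlgebraFbar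
    letI := T.instAlgebraKFbar; letI := T.instIsElliptic
    haveI : Fact (Nat.Prime 7) := ⟨by norm_num⟩
    ∃ (i : Fin (thetaIndex (pilotDataOfK T.D T.K)).lstar) (x₀ : (thetaIndex (pilotDataOfK T.D T.K)).Fibre (.inr ⟨7, by norm_num⟩)),
      (i : ℕ) = (l - 1) / 2 - 1 ∧
      placeOf (pilotDataOfK T.D T.K) 7 x₀ ∈ (pilotDataOfK T.D T.K).S ∧
      (7 : ℝ) ^ ((((i : ℕ) : ℝ) + 2) * (differentOrd 7 (kOf (pilotDataOfK T.D T.K) 7 x₀)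
          + logRadiusA 7 (absRamificationIdx 7 (kOf (pilotDataOfK T.D T.K) 7 x₀))
          + logRadiusB 7 (absRamificationIdx 7 (kOf (pilotDataOfK T.D T.K) 7 x₀))) + 1) *
        ‖(exists_realising_qIdeles_pilotDataOfK T.D).choose ⟨7, by norm_num⟩ x₀‖ ^ (((i : ℕ) + 1) ^ 2 - 1) < 1 := by
  refine GenuineK.exists_deep_place_lamSeven_of_le (n := 7) (by omega) hl (by omega) (by omega) ?_ T
  have hk' : 5 * 21 * ((l - 3) * (l + 1)) ≤ 5 * k * ((l - 3) * (l + 1)) :=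
    Nat.mul_le_mul_right _ (Nat.mul_le_mul_left _ hk)
  refine le_trans ?_ hk'
  have h3 : 3 ≤ l := by omega
  zify [h3]
  have h17' : (17 : ℤ) ≤ (l : ℤ) := by exact_mod_cast h17
  nlinarith [mul_nonneg (sub_nonneg.mpr h17') (by positivity : (0 : ℤ) ≤ 23 * (l : ℤ) + 79)]

end Summit.ABC.IUTFork.Conditional

end
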